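import Summits.QuantumFields.YangMills.Theorems.BalabanUVNodesN19RateEdgeHolderD4AtLedgerReading
import Summits.QuantumFields.YangMills.Theorems.BalabanUVNodesN19RateEdgeHolderD4AtN16PinnedReadingFSC
import Summits.QuantumFields.YangMills.Theorems.BalabanUVNodesK3V5Defs

/-!
# BalabanUVNodes ∕ N19 — K3⁷ v5 BY NAME AT ITS FULL KEY AND THE LEDGER READING: stub 2's N19′ conjunct `K3V5Defs.KeyedCoreEdgeHolderD4 β cr (K3V5Defs.rrOfRecord 𝔯 ksel)` from
# `K3V5Defs.GuardedReadingN16 𝔯 ksel ℓ ℓ₃ g B` ALONE (all three object pins and the three N16 rows read from it), K1⁷'s window, node U3's uniform letters, the bundle decay letter `hdecT`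
# ((T) = the (D4) letter ∀μν at the pin, dag-n19-w5) and the LEDGER link reading `hlinkLedger` (NODE O's ledger world, 74-line binder); the plug; the crux's statement CONDITIONALLY

Cell `pub-ymgap`, HUMAN RULING D-0062 (Track A), WIDTH SEAT `pub-ymgap-dag-n19-w3` (N19 NE7, seat 3 of 3), generation g3; bus INTENT-8(b).  Cluster item K3⁷ «SpineGivenEndpointR13SepCoPH»
(stmt-QuantumFields-20544), plan's skeleton **v5 941dddb108cbaacf**; dag-n27-w1's BY-NAME MIRROR `…K3V5Defs` (p606160).  Filed `--kind proof --supports` that item `--as helper` (proves no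
registered stub).  COUNT-NEUTRAL.  THEOREMS ONLY; 0 `def`; 0 `sorry`; `N = 2`, the item guard, reading-generic `cr`.  Imports the siblings `…AtLedgerReading` (this seat g3: the ledger reading +
`hdecT` IS the keyed reading) and `…AtN16PinnedReadingFSC` (p607220: v5's conjunct TEXT at generic `N`, `G`), and `…K3V5Defs` — CITED BY NAME, none edited.  This is the END of the
n19-w3 lineage at v5's key: every object-pin and letter row of `GuardedReadingN16` that the link reading could read has been read; what it still displays is NODE O's ledger world.

WHAT THIS FILE PROVES (section hypotheses — ALL HYPOTHESES: `hG16 : GuardedReadingN16 𝔯 ksel ℓ ℓ₃ g B`, `hβ1 : β ≤ 1`, `hβw` = K1⁷'s interval-form window with `0 < b` per guarded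
admissible tuple (`DagBinding.WorldP.b_pos`), `hunif` = node U3's uniform letters on `𝔯`, `hdecT` = one-constant decay of `R.u3.EA` on every tuning window (⟸ def-W1's (D4) letter ∀μν +
N22's slot, dag-n19-w5 `decayBound_rateCarriersOfRecord₁₃CoPH_of_pin`), `hlinkLedger` = the sibling's ledger link reading at `N = 2` with the item guard spelled).
* ★★★ `keyedCoreEdgeHolderD4_rrOfRecord_of_guardedReadingN16_ledgerLinkReading : KeyedCoreEdgeHolderD4 β cr (rrOfRecord 𝔯 ksel)` — stub 2's N19′ conjunct BY NAME.
* ★★ `hybridNE7Under_of_guardedReadingN16_keyedFaces_ledgerLinkReading` — + stub 1's `KeyedRatesHolderD4 β (rrOfRecord 𝔯 ksel)` + `KeyedRelWeight cr` ∕ `KeyedShellWeight cr` ∕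
  `KeyedExtraction cr` ⇒ `HybridNE7Under (datumOfRecord₁₃CoPH F 2 θ hP) (EndpointExistence …)` per guarded admissible tuple (composer `keyedGuarded₁₃CoPH_of_keyedFacesP_fsc`, p595910).
* ★★ `spineGivenEndpointR13SepCoPH_of_guardedReadingN16_keyedFaces_ledgerLinkReading` — the same ⇒ `…Theses.BalabanUVNodes.SpineGivenEndpointR13SepCoPH` CONDITIONALLY (`hP.toCore`):
  THE LOCATED N19′-SIDE BILL OF K3⁷ AT v5's FULL KEY — NODE O's ledger world `hlinkLedger` (0∕1 inhabited; its (i) obligation `LedgerAtSync` has zero deviation left-hand sides under the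
  kernel pin, dag-n19-w5), the bundle decay letter, K1⁷'s rung-2 window, node U3's uniform letters, v5's key (producers of `∃ ℓ₃ g B` by name modulo N05 + [Balaban1985Variational] Thm 1;
  `KeyedLive` the guard), stub 1's rates conjunct (dag-n27-w1's bill), stub 2's N20 ∕ N21 ∕ N27x faces at `cr`.

HONEST FRAMING.  Count-neutral kernel bookkeeping; every antecedent is a HYPOTHESIS; the last theorem is a CONDITIONAL reading of the crux's statement, NOT a proof of it — K3⁷
stmt-QuantumFields-20544 stays OPEN and UNCLAIMED, no stub is proved, the skeleton v5 is untouched; nothing of Bałaban's asserted or instantiated (K0⁷ OPEN); NE7 NOT PRINTED ∕ NOT proved;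
N14 ∕ N16 ∕ N19 ∕ N22 NOT discharged; counts unmoved (typed 28∕28 · discharged 5∕27 · A 5∕28).  One finite four-torus at fixed ε — R4 closes the CONDITIONAL finite-𝕋⁴ rung `BalabanLadder.UV`
only; NOT infinite volume ∕ OS ∕ mass gap; the YM mass gap (Clay) is NOT proved by any of this.  Standard axioms.  Edits nothing.
-/

set_option autoImplicit false

noncomputable section

open Finset MeasureTheory
open scoped BigOperators Matrix Matrix.Norms.L2Operator

namespace Summit.QuantumFields.YangMills.BalabanUVNodes.N19KeyedCoreEdgeHolderD4LedgerK3V5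

open Literature.MathematicalPhysics.QuantumFieldTheory.Balaban1983to89
open T4OutputRate T4RecentScale T4GoodClassBudget T4CauchySum T4TowerRateComposition T4TowerRateDischarge
open T4EtaRateMin (Readings NE3Shape)
open T4RateLiaison (GaugeDominated)
open FlowStep (RGEqH prefixOf)
open TreeLengthTorus (TFaceConnected torusTreeLen)
open B12TreeDecay (kappa₀)
open Summit.QuantumFields.BalabanUV.T4Continuum
open AveragingDeficitDualResidual (dualC1 dualC2)
open AveragingDeficitDerivWallProof (wallConst)
open AveragingDeficitPeriodicCounting (IsPeriodicDir)
open MinimalActionSandwich (IsMinimiser minAct)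
open MinimalActionRate (sfClass)
open MinimalActionRefine (RegularSup gradConst)
open NE3EnergyShapes (IsUnitarySite IsPeriodicSite)
open NE3.LeafIndexSockets (LeafH3sup)
open Summit.QuantumFields.BalabanUV.T4Continuum.Spine
open Summit.QuantumFields.BalabanUV.T4Continuum.Spine.NE4 (runFlow)
open Summit.QuantumFields.BalabanUV.T4Continuum.NE1p.DressedRoot (DressedTower DressedStabilityStrict)
open Summit.QuantumFields.YangMills.BalabanUVNodes.N19LedgerLinkSync (LedgerDataSync LedgerAtSync)
open YMDAG.UVSplit (SpineCarriers SpineRecordPred InputsPred U3Carriers RateCarriers RateRecordPred N14At N18At N22At ReadOutAt)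
open Summit.QuantumFields.YangMills.BalabanUVNodes.N16HolderDefs (CovRootHolder N16HolderAt)
open Summit.QuantumFields.YangMills.BalabanUVNodes.SpineRatesHolder (RatesHolderAt)
open Literature.MathematicalPhysics.QuantumFieldTheory.Balaban1983to89.T4Continuum (T4Family ULoop)
open YMDAG.UVSplit (Datum RateReading₁₃CoPH rateCarriersOfRecord₁₃CoPH ne3OfRecord₁₁)
open Node00 (Stage13HParams datumOfRecord₁₃CoPH SiteSeqKey NE3Letters₁₁ ne3ConstLayerOfRecord₁₁ ne3NperOfRecord₁₁ ne3DomOfRecord₁₁)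
open Summit.QuantumFields.YangMills.BalabanUVNodes.N16PinnedLayer13CoPH (N16PinnedLoose N16LettersEnd)
open YMDAG.N14.TopBorn (ne1OfRecord obsSupNorm)
open YMDAG.N14.TopBorn (obsSupNorm_nonneg)
open Node00 (U3Letters₁₁)
open Literature.MathematicalPhysics.QuantumFieldTheory.Balaban1983to89.Node00.U3OfKernels (objectsOfRecord₁₃)
open T4WeightBudget (RelWeightBound)
open T4IndicatorShell (ShellWeightBound)
open T4ContinuumYM4Torus (ForSmallCouplings)
open T4ApexHybrid (HybridNE7Under)
open Summit.QuantumFields.YangMills.BalabanUVNodes.N19CoreEdgeFSCComposer (keyedGuarded₁₃CoPH_of_keyedFacesP_fsc)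
open Summit.QuantumFields.YangMills.BalabanUVNodes.N19RateEdgeHolderD4AtN16PinnedReadingFSC (keyedCoreEdgeHolderD4_of_linkReadingAtN16PinnedReading)
open Summit.QuantumFields.YangMills.BalabanUVNodes.N19RateEdgeHolderD4AtPinnedReading (linkReadingAtN16PinnedReading_of_linkReadingAtPinnedReading)
open Summit.QuantumFields.YangMills.BalabanUVNodes.N19RateEdgeHolderD4AtKeyedReading (linkReadingAtPinnedReading_of_linkReadingAtKeyedReading)
open Summit.QuantumFields.YangMills.BalabanUVNodes.N19RateEdgeHolderD4AtLedgerReading (linkReadingAtKeyedReading_of_linkReadingAtLedgerReading)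
open Summit.QuantumFields.YangMills.Theorems.K3V5Defs (SpineReading RunSel LetterReading rrOfRecord PHolderD4 KeyedRatesHolderD4 GuardedReadingN16 KeyedRelWeight KeyedShellWeight
  KeyedCoreEdgeHolderD4 KeyedExtraction)


section ByName

variable (cr : SpineReading) (𝔯 : RateReading₁₃CoPH 2) (ksel : RunSel) (ℓ : LetterReading) (ℓ₃ : T4Family → NE3Letters₁₁) (g B : T4Family → ℝ) {β : ℝ} (hβ1 : β ≤ 1)
  (hG16 : GuardedReadingN16 𝔯 ksel ℓ ℓ₃ g B)
    (hβw : ∀ (F : T4Family) (θ : Stage13HParams F 2) (hP : θ.Provisos₁₃CoPH F 2), (θ.ZhUnity F 2 ∧ θ.SlotsNondegenerate₁₃ F 2) → θ.Admissible F 2 →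
      ∃ γ₀ b b' : ℝ, 0 < γ₀ ∧ 0 < b ∧ DagBinding.BetaBoundsInInterval (datumOfRecord₁₃CoPH F 2 θ hP).C.toB12 γ₀ b b')
    (hunif : ∀ (F : T4Family) (θ : Stage13HParams F 2) (hP : θ.Provisos₁₃CoPH F 2), (θ.ZhUnity F 2 ∧ θ.SlotsNondegenerate₁₃ F 2) → θ.Admissible F 2 →
      ∃ M ρ₁ : ℝ, 0 ≤ M ∧ ρ₁ < 1 ∧ ∀ (g₀ : ℕ → ℝ) (os : List (ULoop F)) (k : ℕ), 0 < (rateCarriersOfRecord₁₃CoPH 𝔯 F θ hP g₀ os k).u3.ρ ∧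
        (rateCarriersOfRecord₁₃CoPH 𝔯 F θ hP g₀ os k).u3.ρ ≤ ρ₁ ∧
        (rateCarriersOfRecord₁₃CoPH 𝔯 F θ hP g₀ os k).u3.cr * (rateCarriersOfRecord₁₃CoPH 𝔯 F θ hP g₀ os k).u3.C₉ * (rateCarriersOfRecord₁₃CoPH 𝔯 F θ hP g₀ os k).u3.ω ≤ M)
  (hlinkLedger : ∀ (F : T4Family) (θ : Stage13HParams F 2) (hP : θ.Provisos₁₃CoPH F 2), (θ.ZhUnity F 2 ∧ θ.SlotsNondegenerate₁₃ F 2) → θ.Admissible F 2 →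
    ∀ (γ gIR b : ℝ) (g₀ : ℕ → ℝ), (datumOfRecord₁₃CoPH F 2 θ hP).Tuned γ gIR g₀ → γ ≤ θ.γ → γ ^ 2 ≤ Real.exp (-1) → 0 < b →
    (∀ K m, 0 ≤ m → m < K → b ≤ (datumOfRecord₁₃CoPH F 2 θ hP).βfun m (prefixOf (runFlow (datumOfRecord₁₃CoPH F 2 θ hP) g₀ K) m)) →
    ∀ (os : List (ULoop F)) (k : ℕ),
      let S : SpineCarriers := cr F θ hP g₀ os
      let R : RateCarriers 2 := rateCarriersOfRecord₁₃CoPH 𝔯 F θ hP g₀ os k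
      let D : Datum F 2 := datumOfRecord₁₃CoPH F 2 θ hP
      letI := S.dec
      ∃ (_ : DecidableEq R.u3.C.Dom) (F' : Type) (ι' X' : Type) (_ : MeasurableSpace ι')
        (L : LedgerDataSync R.u3.C F' ι' S.ι) (Rd : Readings ι' X') (bsel : (ℕ → ℝ) → ℝ) (EB : Functional R.u3.C R.u3.C.BgB)
        (θc θ₃ : ℝ) (g : ℕ → ℕ → ℝ)
        (uA : ℕ → ι' → R.u3.C.BgA) (uB : ℕ → ι' → R.u3.C.BgB)
        (Pf : ℕ → Params) (d₀ L₀ Koff : ℕ) (cells : (K j : ℕ) → R.u3.C.Dom → Finset (Site (Pf K) j))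
        (H033 : Flow → ℕ → Prop) (I : Type) (fam : I → B14.Sect2Data) (Lb βw : ℝ) (κ₁ : ℕ) (Gv Cl : ℝ) (K₁ : ℕ)
        (dressed : R.u3.C.Dom → Prop) (_ : DecidablePred dressed)
        (c' t θ γ₃ l₁ : ℝ)
        (sel : ℕ → (B7Prop1Explicit.Site 4 → Fin 4 → (Matrix (Fin 2) (Fin 2) ℂ)ˣ) → (B7Prop1Explicit.Site 4 → Fin 4 → (Matrix (Fin 2) (Fin 2) ℂ)ˣ))
        (rd : ι' → (B7Prop1Explicit.Site 4 → Fin 4 → (Matrix (Fin 2) (Fin 2) ℂ)ˣ)),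
        (∀ K i, i ≤ K → g K i = runFlow D g₀ K i) ∧ (∀ K i, K < i → g K i = gIR) ∧
        EB = (fun s => R.u3.EB (bsel s) s) ∧
        (∀ (Sz : ℕ → ℝ → S.ι → ℕ → ℝ) (E₀ : ℝ) (m : ℕ) (a : ℝ) (Cw Λg : ℝ),
          (∀ K t, |t| ≤ S.l₀ → ∀ τ ∈ S.T K \ S.Bad K t, ∀ v ∈ Rd.dom, ∀ j ≤ K,
            |∑ X ∈ L.fac K t τ with R.u3.C.scale X = j,
                (Real.log (Real.exp (EB (fun i => g (K + 1) (i + 1)) (uB K v) X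
                    - EB (fun i => g (K + 1) (i + 1)) L.oneB X))
                  - Real.log (Real.exp (R.u3.EA (g K) (uA K v) X - R.u3.EA (g K) L.oneA X)))| ≤ Sz K t τ j) →
          0 ≤ E₀ → 0 < a → a < 1 →
          (∀ K t, |t| ≤ S.l₀ → ∀ τ ∈ S.T K \ S.Bad K t, ∀ j ≤ K,
            Sz K t τ j ≤ S.vol * (E₀ * ((K : ℝ) + 1) ^ m * a ^ (K - j))) →
          (∀ K, Multiplicity (L.All K) R.u3.C.scale (fun X => Real.exp (-(R.u3.κ * R.u3.C.d X))) Cw S.vol Λg K) →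
          (∀ K t, |t| ≤ S.l₀ → ∀ τ ∈ S.T K \ S.Bad K t,
            WindowMultiplicity (L.facO K t τ) L.scO L.wO Cw S.vol Λg (jlogOf L.Cl K) K) →
          1 ≤ Λg → L.θ' ≤ Λg →
          LedgerAtSync { L with S := Sz, E₀ := E₀, m := m, a := a, Cw := Cw, Λg := Λg } S.l₀ S.vol S.T S.Bad
            (fun K t τ => S.A K t τ - S.shA K t τ) (fun K t τ => S.B K t τ - S.shB K t τ) Rd R.u3.EA EB R.u3.κ g uA uB
            R.u3.ω θc R.u3.θ θ₃) ∧
        0 ≤ S.vol ∧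
        (∀ K t, |t| ≤ S.l₀ → ∀ τ ∈ S.T K \ S.Bad K t,
          WindowMultiplicity (L.facO K t τ) L.scO L.wO L.Cw S.vol L.Λg (jlogOf L.Cl K) K) ∧
        0 ≤ L.Cw ∧ 1 ≤ L.Λg ∧ L.θ' ≤ L.Λg ∧
        (∀ K, (Pf K).d = d₀) ∧ (∀ K, (Pf K).L = L₀) ∧ (∀ K, (Pf K).K = Koff + K) ∧
        (∀ K, (Fintype.card (Site (Pf K) (Pf K).K) : ℝ) = S.vol) ∧
        kappa₀ (4 * 2 ^ d₀) (2 * d₀) ≤ R.u3.κ ∧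
        (∀ K, ∀ X ∈ L.All K,
          (cells K (R.u3.C.scale X + Koff) X).Nonempty ∧ TFaceConnected (cells K (R.u3.C.scale X + Koff) X)) ∧
        (∀ K j, Set.InjOn (cells K j) ↑((L.All K).filter fun X => R.u3.C.scale X + Koff = j)) ∧
        (∀ K, ∀ X ∈ L.All K, torusTreeLen (cells K (R.u3.C.scale X + Koff) X) ≤ R.u3.C.d X) ∧
        B14.Thm2Printed H033 fam Lb βw κ₁ ∧ βw < 1 ∧ 0 < βw ∧ 1 < Lb ∧ 1 ≤ Gv ∧ 0 ≤ Cl ∧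
        (∀ K t, |t| ≤ S.l₀ → ∀ τ ∈ S.T K \ S.Bad K t, ∀ j ≤ K, ∃ (i : I) (w : (fam i).Ω) (j' : ℕ),
          (fam i).flow.SatisfiesRG (fam i).K ∧ H033 (fam i).flow (fam i).K ∧ 1 ≤ j' ∧ j' ≤ (fam i).K ∧
          (fam i).K - j' = K - j ∧ (fam i).K ≤ K + K₁ ∧
          (∀ n, 0 ≤ (fam i).gammaVol n w) ∧ (fam i).gammaVol (fam i).K w ≤ S.vol ∧
          (∀ n, n < (fam i).K → n < jlogOf Cl (fam i).K → (fam i).gammaVol n w = 0) ∧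
          (∀ n, n < (fam i).K → jlogOf Cl (fam i).K ≤ n → (fam i).gammaVol n w ≤ S.vol * Gv ^ ((fam i).K - n))) ∧
        (∀ K t, |t| ≤ S.l₀ → ∀ τ ∈ S.T K \ S.Bad K t,
          (∀ X ∈ (L.fac K t τ).filter (fun X => dressed X), R.u3.C.scale X = K) ∧
          ((L.fac K t τ).filter (fun X => dressed X)).card ≤ 1 ∧
          ((((L.fac K t τ).filter (fun X => dressed X)).card : ℝ) ≤ S.vol)) ∧
        R.ne3.g = gradConst 4 c' ∧ 0 ≤ c' ∧ R.ne3.b ≤ t ∧ c' ≤ t ∧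
        (2 : ℝ) ^ 91 * (R.ne3.L : ℝ) ^ 17 * t ≤ 1 ∧ (2 : ℝ) ^ 76 * (R.ne3.L : ℝ) ^ 12 * t ≤ R.ne3.ε ∧
        16 * B7Prop2Explicit.C0 4 * R.ne3.ε ≤ 3 ∧ 1024 * (4 + 1) * (4 + 4) * (R.ne3.L : ℝ) ^ 2 * R.ne3.ε ≤ 1 ∧
        4 * ((ℓ₃ F).ε / B F) ≤ c' ∧
        LeafH3sup 4 R.ne3.L R.ne3.Nper R.ne3.ε R.ne3.b c' R.ne3.dom ∧
        (∀ V ∈ R.ne3.dom, ∀ k : ℕ, IsMinimiser 4 (sfClass 4 R.ne3.L R.ne3.Nper R.ne3.ε) R.ne3.L R.ne3.Nper k V (sel k V)) ∧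
        (∀ V ∈ R.ne3.dom, ∀ k : ℕ, RegularSup 4 R.ne3.L R.ne3.Nper R.ne3.b c' k (sel k V)) ∧
        0 < θ ∧ θ ^ 6 = ((R.ne3.L : ℝ))⁻¹ ∧ 0 < γ₃ ∧
        R.ne3.C * (wallConst 4 R.ne3.L * (R.ne3.Nper : ℝ) ^ 2 *
          (Real.sqrt (gradConst 4 c') * dualC2 4 R.ne3.L + 2 * R.ne3.b ^ 2 * dualC1 4 R.ne3.L)) ≤ γ₃ ^ 3 ∧
        0 < l₁ ∧ R.ne3.Λ₁ ≤ l₁ ^ 3 ∧ γ₃ * θ ^ 2 ≤ l₁ * R.ne3.Nper ∧ θ ^ ((3 : ℝ) * β - 2) ≤ θ₃ ∧ θ₃ < 1 ∧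
        (∀ v ∈ Rd.dom, rd v ∈ R.ne3.dom) ∧
        (∀ k, ∀ v ∈ Rd.dom, Rd.act k v = minAct 4 (sfClass 4 R.ne3.L R.ne3.Nper R.ne3.ε) R.ne3.L R.ne3.Nper k (rd v)) ∧
        (R.ne3.Nper : ℝ) ^ 4 ≤ Rd.vol ∧
        R.u3.ρ ≤ θc ∧
        (∀ s ∈ Window γ, 0 < bsel s ∧ bsel s ≤ γ))

include hβ1 hG16 hβw hunif hlinkLedger

/-- ★★★ **STUB 2's N19′ CONJUNCT `KeyedCoreEdgeHolderD4 β cr (rrOfRecord 𝔯 ksel)` BY NAME, KEYED ON `GuardedReadingN16` ALONE, AT THE LEDGER READING** [bookkeeping]: GIVEN v5's key (all three object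
pins READ from its first conjunct — the (t-N14) letters `(l₀, Λ)` with `0 < l₀`, `0 ≤ Λ`, the (t-U3) kernel pin — and the three N16 rows from the rest), `β ≤ 1`, K1⁷'s window `hβw`, the
uniform U3 letters `hunif`, the bundle decay letter `hdecT` and the LEDGER link reading `hlinkLedger` at `N = 2` with the item guard spelled (0 instances): `K3V5Defs.KeyedCoreEdgeHolderD4 β cr (K3V5Defs.rrOfRecord 𝔯 ksel)`
— four rebuilds (`…AtLedgerReading` → `…AtKeyedReading` → `…AtPinnedReading` → `…AtN16PinnedReading`) feeding the FSC sibling's ★★★.  ONE FACE of `stub_expansion13H` modulo displayed hypotheses — NOT the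
stub, NOT K3⁷; N14 ∕ N16 ∕ N19 NOT discharged. -/
theorem keyedCoreEdgeHolderD4_rrOfRecord_of_guardedReadingN16_ledgerLinkReading
    (hdecT : ∀ (F : T4Family) (θ : Stage13HParams F 2) (hP : θ.Provisos₁₃CoPH F 2), (θ.ZhUnity F 2 ∧ θ.SlotsNondegenerate₁₃ F 2) → θ.Admissible F 2 →
      ∀ γ : ℝ, γ ≤ θ.γ → ∀ (g₀ : ℕ → ℝ) (os : List (ULoop F)) (k : ℕ), ∃ E₀ : ℝ, 0 ≤ E₀ ∧
        DecayBound (rateCarriersOfRecord₁₃CoPH 𝔯 F θ hP g₀ os k).u3.EA (Window γ) E₀ (rateCarriersOfRecord₁₃CoPH 𝔯 F θ hP g₀ os k).u3.κ) :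
    KeyedCoreEdgeHolderD4 β cr (rrOfRecord 𝔯 ksel) := by
  obtain ⟨⟨hpin1ex, -, -, hpinU3⟩, hpinL, hend, hmatch⟩ := hG16
  obtain ⟨l₀, Λ, hl₀, hΛ, hpin1⟩ := hpin1ex
  exact fun F θ hP hGd hθ hB hE =>
    keyedCoreEdgeHolderD4_of_linkReadingAtN16PinnedReading cr 𝔯 (fun θ => θ.ZhUnity _ 2 ∧ θ.SlotsNondegenerate₁₃ _ 2) hβ1
      (linkReadingAtN16PinnedReading_of_linkReadingAtPinnedReading cr 𝔯 (fun θ => θ.ZhUnity _ 2 ∧ θ.SlotsNondegenerate₁₃ _ 2)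
        (linkReadingAtPinnedReading_of_linkReadingAtKeyedReading cr 𝔯 (fun θ => θ.ZhUnity _ 2 ∧ θ.SlotsNondegenerate₁₃ _ 2)
          (linkReadingAtKeyedReading_of_linkReadingAtLedgerReading cr 𝔯 (fun θ => θ.ZhUnity _ 2 ∧ θ.SlotsNondegenerate₁₃ _ 2) hlinkLedger hdecT) hl₀.le ℓ hpinU3) hl₀.le hΛ hpin1)
      hpinL hmatch hend ksel hβw hunif F θ hP hGd hθ hB hE

/-- ★★ **`HybridNE7Under` PER GUARDED ADMISSIBLE TUPLE FROM v5's KEY, STUB 1's RATES CONJUNCT, STUB 2's OTHER FACES BY NAME, THE LEDGER READING** [bookkeeping]: composer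
`keyedGuarded₁₃CoPH_of_keyedFacesP_fsc` (p595910) with `h19 := ★★★`.  Hypotheses displayed; NOT K3⁷; no stub proved; N19 NOT discharged. -/
theorem hybridNE7Under_of_guardedReadingN16_keyedFaces_ledgerLinkReading
    (hdecT : ∀ (F : T4Family) (θ : Stage13HParams F 2) (hP : θ.Provisos₁₃CoPH F 2), (θ.ZhUnity F 2 ∧ θ.SlotsNondegenerate₁₃ F 2) → θ.Admissible F 2 →
      ∀ γ : ℝ, γ ≤ θ.γ → ∀ (g₀ : ℕ → ℝ) (os : List (ULoop F)) (k : ℕ), ∃ E₀ : ℝ, 0 ≤ E₀ ∧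
        DecayBound (rateCarriersOfRecord₁₃CoPH 𝔯 F θ hP g₀ os k).u3.EA (Window γ) E₀ (rateCarriersOfRecord₁₃CoPH 𝔯 F θ hP g₀ os k).u3.κ)
    (hr : KeyedRatesHolderD4 β (rrOfRecord 𝔯 ksel))
    (h20 : KeyedRelWeight cr) (h21 : KeyedShellWeight cr) (hx : KeyedExtraction cr)
    (F : T4Family) (θ : Stage13HParams F 2) (hP : θ.Provisos₁₃CoPH F 2) (hGd : θ.ZhUnity F 2 ∧ θ.SlotsNondegenerate₁₃ F 2) (hθ : θ.Admissible F 2) :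
    HybridNE7Under (datumOfRecord₁₃CoPH F 2 θ hP) (DagBinding.EndpointExistence (datumOfRecord₁₃CoPH F 2 θ hP).C.toB12) :=
  keyedGuarded₁₃CoPH_of_keyedFacesP_fsc cr (rrOfRecord 𝔯 ksel) (fun θ => θ.ZhUnity _ 2 ∧ θ.SlotsNondegenerate₁₃ _ 2) (PHolderD4 β) h20 h21 hr
    (keyedCoreEdgeHolderD4_rrOfRecord_of_guardedReadingN16_ledgerLinkReading cr 𝔯 ksel ℓ ℓ₃ g B hβ1 hG16 hβw hunif hlinkLedger hdecT) hx F θ hP hGd hθ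

/-- ★★ **K3⁷'s STATEMENT BY NAME, CONDITIONALLY, AT v5's FULL KEY AND THE LEDGER READING** [bookkeeping]: `…Theses.BalabanUVNodes.SpineGivenEndpointR13SepCoPH` from the displayed HYPOTHESES (v5's key
`GuardedReadingN16`, stub 1's rates conjunct, stub 2's N20 ∕ N21 ∕ N27x faces at `cr`, K1⁷'s window, node U3's uniform letters, the bundle decay letter `hdecT`, the ledger link reading `hlinkLedger`) — the previous theorem
at `hP.toCore`.  A CONDITIONAL reading of the crux; NOT a proof of K3⁷ (OPEN, unclaimed); no stub proved; nothing of Bałaban asserted; N19 NOT discharged; counts unmoved. -/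
theorem spineGivenEndpointR13SepCoPH_of_guardedReadingN16_keyedFaces_ledgerLinkReading
    (hdecT : ∀ (F : T4Family) (θ : Stage13HParams F 2) (hP : θ.Provisos₁₃CoPH F 2), (θ.ZhUnity F 2 ∧ θ.SlotsNondegenerate₁₃ F 2) → θ.Admissible F 2 →
      ∀ γ : ℝ, γ ≤ θ.γ → ∀ (g₀ : ℕ → ℝ) (os : List (ULoop F)) (k : ℕ), ∃ E₀ : ℝ, 0 ≤ E₀ ∧
        DecayBound (rateCarriersOfRecord₁₃CoPH 𝔯 F θ hP g₀ os k).u3.EA (Window γ) E₀ (rateCarriersOfRecord₁₃CoPH 𝔯 F θ hP g₀ os k).u3.κ)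
    (hr : KeyedRatesHolderD4 β (rrOfRecord 𝔯 ksel))
    (h20 : KeyedRelWeight cr) (h21 : KeyedShellWeight cr) (hx : KeyedExtraction cr) :
    Summit.QuantumFields.YangMills.Theses.BalabanUVNodes.SpineGivenEndpointR13SepCoPH :=
  fun F θ hP hGd hθ _ _ =>
    hybridNE7Under_of_guardedReadingN16_keyedFaces_ledgerLinkReading cr 𝔯 ksel ℓ ℓ₃ g B hβ1 hG16 hβw hunif hlinkLedger hdecT hr h20 h21 hx F θ hP.toCore hGd hθ

end ByName

end Summit.QuantumFields.YangMills.BalabanUVNodes.N19KeyedCoreEdgeHolderD4LedgerK3V5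
end
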